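import Mathlib
import HarnessLib
import Summits.AtomisticToContinuum.HydrodynamicLimit.Theses.TwoClocks
import Literature.MathematicalPhysics.KineticTheory.HardSphereEulerProofs
import Literature.Analysis.FunctionSpaces.TorusCalculus

/-!
# Sketch — crux idea `mass-potential-gauge` for `KineticWindowLDUniform` (stmt-AtomisticToContinuum-14442)

First lemmas of the line (crux-ideate stage: `def … : Prop` statements that ELABORATE; no skeleton, no
`stub_*`, no `_of`).  Ideator 2, round 1 (planner-cruxidea-stmt-AtomisticToContinuum-14442-2-0).

The lever.  The three local-equilibrium profiles `(a, u₀, θ₀)` of the crux's reference law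
`λ = localGibbsLaw σ a u₀ θ₀ N Φ` are traded for three EQUILIBRIUM notions of classical mechanics:

* velocity profile `u₀`  ↦  a local Galilean FRAME: `λ_{a,u₀,θ₀}` is the image of `λ_{a,0,θ₀}` under the
  fibrewise shift `vᵢ ↦ vᵢ + u₀(xᵢ)` (`GalileanGaugePushforward`, exact, static);
* temperature profile `θ₀`  ↦  a position-dependent MASS `m(x) = θ̄/θ₀(x)` at ONE temperature `θ̄`;
* activity profile `a`  ↦  an external POTENTIAL `U(x) = -θ̄ (log a(x) + (3/2) log θ₀(x))`;

so that `λ_{a,0,θ₀}` is EXACTLY the canonical Gibbs state `e^{-H/θ̄} dx dp` of the hard-sphere Hamiltonian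
`H = Σᵢ |pᵢ|²/(2 m(xᵢ)) + Σᵢ U(xᵢ)` (+ hard core), written in true kinematic variables `v = p/m(x)`
(`OneBodyStationarity`: the free-flight part; `MassCollideFluxInvariance`: the unequal-mass elastic rule at
contact preserves the contact flux measure).  That Hamiltonian hard-sphere flow `Φ^H` has TRUE kinematics
`ẋ = v`, leaves `λ_{a,0,θ₀}` invariant and is reversible, and over the kinetic window `w_N = τ (N+1)^{-1/3}` it
differs from the true flow `Φ` (seen from the local Galilean frame of each particle) only by velocity seeds of
size `O((N+1)^{-1/3}·polylog N)`; a deterministic shadowing lemma charges the difference to the particles whose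
BACKWARD COLLISION CLUSTER over the window is deep (depth `≳ log N`), near-grazing (margin `(N+1)^{-κ}`) or
fast — an exceptional set of super-extensive large-deviation cost under the INVARIANT law.  Hence
`KineticWindowLDUniform ⇐ K1 ∧ K2`, two statements about `(Φ^H, λ_{a,0,θ₀})` AT EQUILIBRIUM:
`K2` = the window LD for the Hamiltonian flow `Φ^H` at its own equilibrium (`EquilibriumWindowLDFor`, stated
over an abstract admissibility predicate pending the definition item D1 = `MassPotentialHardSphereFlow`),
`K1` = the exponential-scale rarity of the exceptional set (informal in the card).
-/

noncomputable section

open MeasureTheory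
open scoped InnerProductSpace

namespace Summit.AtomisticToContinuum.HydrodynamicLimit.Cruxes.KineticWindowLDUniform.MassPotentialGauge

open Literature.MathematicalPhysics.KineticTheory
open Literature.Analysis.FluidPDE (Config localMaxwellian)
open Literature.Analysis.FunctionSpaces (Torus.IsSmooth Torus.gradient Torus.partialDeriv)

/-- Phase space of the crux: `N + 1` labelled spheres on `𝕋³` with velocities in `ℝ³`. -/
abbrev Phase (N : ℕ) : Type := Config (N + 1) (Fin 3) T3

/-! ### 1. The Galilean gauge (exact, static) -/

/-- The Galilean gauge: shift every velocity by the local frame velocity `u₀(xᵢ)` (positions untouched). -/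
def galileanGauge {N : ℕ} (u₀ : T3 → V3) (z : Phase N) : Phase N :=
  fun i => ((z i).1, (z i).2 + u₀ (z i).1)

/-- **First lemma (a) — `GalileanGaugePushforward` (provable now).**  The local Gibbs law with velocity
profile `u₀` is the push-forward of the driftless local Gibbs law (same activity and temperature profiles)
under the Galilean gauge: given the positions the velocity fibre of `localGibbsMeasure` is the heterogeneous
Gaussian product `⊗ᵢ N(u₀(xᵢ), θ₀(xᵢ) I)` (`lintegral_localGibbsMeasure`, `velMeasure`, `gaussMeasure_eq_map_map`),
the position weights and the partition functions do not see `u₀` (`canonicalPartition_eq_posPartition`). -/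
def GalileanGaugePushforward : Prop :=
  ∀ (σ : ℝ) (a θ₀ : T3 → ℝ) (u₀ : T3 → V3) (N : ℕ), Continuous a → Continuous θ₀ → Continuous u₀ →
    (∀ x, 0 ≤ a x) → (∀ x, 0 < θ₀ x) →
      (localGibbsMeasure σ a (fun _ => (0 : V3)) θ₀ N).map (galileanGauge u₀) = localGibbsMeasure σ a u₀ θ₀ N

/-- The window functional of the crux pulled back by the gauge: for EVERY flow map `Φ` and observable `F`,
`∫ e^{β X^Φ_F} dλ_{a,u₀,θ₀} = ∫ e^{β (X^Φ_F ∘ gauge)} dλ_{a,0,θ₀}` — the crux's left-hand side is an integral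
against the driftless law of a functional of the GAUGED initial datum (change of variables under (a)). -/
def GaugedWindowIdentity : Prop :=
  ∀ (σ : ℝ) (a θ₀ : T3 → ℝ) (u₀ : T3 → V3) (N : ℕ), Continuous a → Continuous θ₀ → Continuous u₀ →
    (∀ x, 0 ≤ a x) → (∀ x, 0 < θ₀ x) →
      ∀ (G : Phase N → ENNReal), Measurable G →
        ∫⁻ z, G z ∂(localGibbsMeasure σ a u₀ θ₀ N) = ∫⁻ z, G (galileanGauge u₀ z) ∂(localGibbsMeasure σ a (fun _ => (0 : V3)) θ₀ N)

/-! ### 2. Temperature = mass, activity = potential (exact, dynamic) -/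

/-- The mass–potential force field (true kinematics `ẋ = v`, `v̇ = G(x,v)`), `θ̄ = 1`:
`G = θ₀ ∇log a + (3/2) ∇θ₀ − (|v|²/2) ∇θ₀/θ₀ + ((v·∇θ₀)/θ₀) v` — Hamilton's equations of
`H = |p|²/(2m(x)) + U(x)`, `m = 1/θ₀`, `U = −(log a + (3/2) log θ₀)`, `p = m v`, rewritten for `v = p/m(x)`.
Even in `v` (the free flight is time-reversible). -/
def massPotentialForce (a θ₀ : T3 → ℝ) (x : T3) (v : V3) : V3 :=
  (θ₀ x) • Torus.gradient (fun y => Real.log (a y)) x + (3 / 2 : ℝ) • Torus.gradient θ₀ x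
    - (‖v‖ ^ 2 / (2 * θ₀ x)) • Torus.gradient θ₀ x + (⟪v, Torus.gradient θ₀ x⟫_ℝ / θ₀ x) • v

/-- **First lemma (b) — `OneBodyStationarity` (calculus identity, provable now).**  The one-body local Gibbs
profile `ρ(x,v) = a(x) M_{1,θ₀(x),0}(v)` (`localGibbsProfile a 0 θ₀`) is a stationary solution of the kinetic
Liouville equation with TRUE streaming and the mass–potential force:
`Σₖ vₖ ∂_{xₖ} ρ + Σₖ ∂_{vₖ}(Gₖ ρ) = 0` pointwise.  (The `N`-body product density is then stationary for the
free-flight part of `Φ^H`; in Hamiltonian variables this is Liouville + `{H, e^{-H}} = 0`.)  The symbolic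
check is kit job j015182 (`gauge_checks.py`, CHECK 1). -/
def OneBodyStationarity : Prop :=
  ∀ (a θ₀ : T3 → ℝ), Torus.IsSmooth a → Torus.IsSmooth θ₀ → (∀ x, 0 < a x) → (∀ x, 0 < θ₀ x) →
    ∀ (x : T3) (v : V3),
      (∑ k : Fin 3, v k * Torus.partialDeriv k (fun y => localGibbsProfile a (fun _ => (0 : V3)) θ₀ (y, v)) x)
        + (∑ k : Fin 3, fderiv ℝ (fun w : V3 =>
            massPotentialForce a θ₀ x w k * localGibbsProfile a (fun _ => (0 : V3)) θ₀ (x, w)) v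
              (EuclideanSpace.single k (1 : ℝ))) = 0

/-- The unequal-mass elastic collision rule at contact normal `n` (masses `mᵢ = m(xᵢ)`, `mⱼ = m(xⱼ)` frozen at
the contact configuration): `vᵢ' = vᵢ − (2mⱼ/(mᵢ+mⱼ)) ((vᵢ−vⱼ)·n) n`, `vⱼ' = vⱼ + (2mᵢ/(mᵢ+mⱼ)) ((vᵢ−vⱼ)·n) n`.
At `mᵢ = mⱼ` it is the tree's `reflectVel`/`collidePair` rule; for spheres at distance `ε_N` it differs from it by
`O(ε_N ‖∇θ₀‖)` — a seed of the shadowing lemma. -/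
def massCollide (mi mj : ℝ) (n : V3) (vi vj : V3) : V3 × V3 :=
  (vi - (2 * mj / (mi + mj) * ⟪vi - vj, n⟫_ℝ) • n, vj + (2 * mi / (mi + mj) * ⟪vi - vj, n⟫_ℝ) • n)

/-- **First lemma (c) — `MassCollideFluxInvariance` (algebra, provable now).**  The unequal-mass rule conserves
`mᵢ|vᵢ|² + mⱼ|vⱼ|²` and `mᵢvᵢ + mⱼvⱼ`, reverses the normal relative velocity and is an involution; hence it maps
the incoming contact flux measure `ρ ((vᵢ−vⱼ)·n)₋ dvᵢ dvⱼ` of the Gibbs density of `H` onto the outgoing one —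
the boundary condition for the EXACT invariance of `λ_{a,0,θ₀}` under `Φ^H` (kit j015182, CHECK 2: also
`|det| = 1`). -/
def MassCollideFluxInvariance : Prop :=
  ∀ (mi mj : ℝ), 0 < mi → 0 < mj → ∀ (n : V3), ‖n‖ = 1 → ∀ (vi vj : V3),
    let p := massCollide mi mj n vi vj
    mi * ‖p.1‖ ^ 2 + mj * ‖p.2‖ ^ 2 = mi * ‖vi‖ ^ 2 + mj * ‖vj‖ ^ 2 ∧
      mi • p.1 + mj • p.2 = mi • vi + mj • vj ∧
      ⟪p.1 - p.2, n⟫_ℝ = -⟪vi - vj, n⟫_ℝ ∧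
      massCollide mi mj n p.1 p.2 = (vi, vj)

/-! ### 3. The equilibrium core `K2` (over an abstract admissibility predicate; D1 makes it concrete) -/

/-- The window functional of the crux for a flow MAP `Ψ : ℝ → Phase N → Phase N` (not necessarily a
`HardSphereFlow`): `X(z) = Σᵢ w⁻¹ ∫₀ʷ F((Ψ r z)ᵢ) dr`, `w = τ (N+1)^{-1/3}`. -/
def windowSum {N : ℕ} (Ψ : ℝ → Phase N → Phase N) (F : T3 × V3 → ℝ) (τ : ℝ) (z : Phase N) : ℝ :=
  ∑ i : Fin (N + 1), (τ * ((N : ℝ) + 1) ^ (-(1 / 3 : ℝ)))⁻¹ *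
    ∫ r in (0 : ℝ)..(τ * ((N : ℝ) + 1) ^ (-(1 / 3 : ℝ))), F ((Ψ r z) i)

/-- `K2` — **window LD at equilibrium for an admissible class of `λ_{a,0,θ₀}`-preserving flows.**  Verbatim the
crux with `u₀ := 0`, except that the flow ranges over `Adm σ a θ₀ N` (intended inhabitant, definition item D1:
the mass–potential hard-sphere flows `Φ^H` of reduced diameter `σ`, for which `λ_{a,0,θ₀}` is INVARIANT and
REVERSIBLE — an honest Hamiltonian hard-sphere gas at global equilibrium in a macroscopically smooth mass and
potential landscape).  With `Adm :=` "is a `HardSphereFlow` of diameter `hsDiameter σ N`" and constant `a, θ₀` this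
is literally `TwoClocks.EquilibriumFastWindowLD` (crux 2, stmt-14440); the card's claim is
`KineticWindowLDUniform ⇐ K1 ∧ EquilibriumWindowLDFor Adm_{D1}`. -/
def EquilibriumWindowLDFor
    (Adm : (σ : ℝ) → (a θ₀ : T3 → ℝ) → (N : ℕ) → (ℝ → Phase N → Phase N) → Prop) : Prop :=
  ∃ η₀ : ℝ, 0 < η₀ ∧ ∀ (a θ₀ : T3 → ℝ), Torus.IsSmooth a → Torus.IsSmooth θ₀ → (∀ x, 0 < a x) → (∀ x, 0 < θ₀ x) →
    ∀ σ : ℝ, 0 < σ → σ ^ 3 * (⨆ x, a x) ≤ η₀ * ∫ x, a x →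
      ∀ Ψ : (N : ℕ) → (ℝ → Phase N → Phase N), (∀ N, Adm σ a θ₀ N (Ψ N)) →
        ∀ F : T3 × V3 → ℝ, Continuous F → (∃ C : ℝ, ∀ y, |F y| ≤ C * (1 + ‖y.2‖ ^ 2)) →
          (∀ x, ∫ v, F (x, v) * localMaxwellian 1 (θ₀ x) (0 : V3) v = 0) →
          (∀ x (j : Fin 3), ∫ v, F (x, v) * v j * localMaxwellian 1 (θ₀ x) (0 : V3) v = 0) →
          (∀ x, ∫ v, F (x, v) * ‖v‖ ^ 2 * localMaxwellian 1 (θ₀ x) (0 : V3) v = 0) →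
            ∃ β₀ : ℝ, 0 < β₀ ∧ ∀ β : ℝ, |β| ≤ β₀ → ∀ ε : ℝ, 0 < ε → ∃ τ : ℝ, 0 < τ ∧ ∃ N₀ : ℕ, ∀ N : ℕ, N₀ ≤ N →
              ∫⁻ z, ENNReal.ofReal (Real.exp (β * windowSum (Ψ N) F τ z))
                  ∂(localGibbsMeasure σ a (fun _ => (0 : V3)) θ₀ N) ≤
                ENNReal.ofReal (Real.exp (ε * ((N : ℝ) + 1)))

/-- The minimal admissibility any inhabitant of D1 must satisfy and that every equilibrium manipulation of the
line uses (Hölder window-monotonicity, Jensen-in-time truncation, Koopman unitarity on `L²(λ)`): the flow map is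
measurable, a group on a conull measurable good set, and PRESERVES `λ_{a,0,θ₀}`.  (Not sufficient alone — the
identity flow preserves `λ` and violates `K2` by the Disproof's one-free-sphere computation; D1 adds "orbits are
mass–potential hard-sphere trajectories of reduced diameter `σ`".) -/
def PreservesLocalGibbs (σ : ℝ) (a θ₀ : T3 → ℝ) (N : ℕ) (Ψ : ℝ → Phase N → Phase N) : Prop :=
  (∀ t, Measurable (Ψ t)) ∧
    ∃ good : Set (Phase N), MeasurableSet good ∧ localGibbsMeasure σ a (fun _ => (0 : V3)) θ₀ N goodᶜ = 0 ∧
      (∀ t, Set.MapsTo (Ψ t) good good) ∧ (∀ z ∈ good, Ψ 0 z = z) ∧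
      (∀ s t, ∀ z ∈ good, Ψ (s + t) z = Ψ s (Ψ t z)) ∧
      ∀ t, MeasurePreserving (Ψ t) (localGibbsMeasure σ a (fun _ => (0 : V3)) θ₀ N)
        (localGibbsMeasure σ a (fun _ => (0 : V3)) θ₀ N)

/-- Sanity: the crux's decl is in scope under its route name (the line's composition will conclude it BY NAME). -/
example : Prop := Summit.AtomisticToContinuum.HydrodynamicLimit.Theses.TwoClocks.KineticWindowLDUniform

end Summit.AtomisticToContinuum.HydrodynamicLimit.Cruxes.KineticWindowLDUniform.MassPotentialGauge

end
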